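import Summits.NavierStokesRegularity.NavierStokesRegularity.Theses.PerpetualPump
import Summits.NavierStokesRegularity.NavierStokesRegularity.Theorems.PerpetualPumpAveragedTypeIBlowupTransfer
import Summits.NavierStokesRegularity.NavierStokesRegularity.Theorems.PerpetualPumpAveragedTypeIBlowupNoext
import Summits.NavierStokesRegularity.NavierStokesRegularity.Theorems.PerpetualPumpAveragedTypeIBlowupModeNormBound
import Summits.NavierStokesRegularity.NavierStokesRegularity.Theorems.PerpetualPumpAveragedTypeIBlowupSupBound
import Summits.NavierStokesRegularity.NavierStokesRegularity.Theorems.PerpetualPumpAveragedTypeIBlowupSynthField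
import Summits.NavierStokesRegularity.NavierStokesRegularity.Theorems.PerpetualPumpAveragedTypeIBlowupSynthMild
import Summits.NavierStokesRegularity.NavierStokesRegularity.Theorems.PerpetualPumpAveragedTypeIBlowupChainContinuation
import Summits.NavierStokesRegularity.NavierStokesRegularity.Theorems.PerpetualPumpAveragedTypeIBlowupKernel
import Summits.NavierStokesRegularity.NavierStokesRegularity.Theorems.PerpetualPumpAveragedTypeIBlowupDieGlobalUnique
import Summits.NavierStokesRegularity.NavierStokesRegularity.Theorems.PerpetualPumpPumpTransferSummation
import Summits.NavierStokesRegularity.NavierStokesRegularity.Theorems.PerpetualPumpPumpTransferMajorantOfEnvelope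
import Summits.NavierStokesRegularity.NavierStokesRegularity.Theorems.PerpetualPumpPumpTransferNoLonger
import Literature.Analysis.FluidPDE.TaoAveragedCascadeHolds
import Literature.Analysis.FluidPDE.TaoCascadeModeDuhamel
import HarnessLib

/-!
# Line `Sketch` for crux `PerpetualPump.PumpTransfer` (stmt-NavierStokesRegularity-1837)
# — LEAD'S SKELETON v3 (prover-line-stmt-NavierStokesRegularity-1837-c1-0, 2026-08-16, cycle 1 of lead c1)

`PumpTransfer := CircuitPump → AveragedTypeIBlowup` (both inlined). Every line for this crux proves the
CONSEQUENT (Disproof findings 2/5/7, triage C2: the anonymous `CircuitPump` witness carries no hyperbolicity),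
so the research content of this crux is the research content of crux #3 `AveragedTypeIBlowup` (stmt-1835).

History. v1/v2 (lead -0): exact heat-fibre lift; synthesis stubs + Volterra local theory LANDED
(`Theorems/PerpetualPumpPumpTransfer{ModeCoeffOfBandField,LinftyOfBandField,BandFieldExists,MildOfBandField,
VolterraLocal,VolterraMaximal}.lean`); one research stub `stub_rayTypeI` (fibre formulation) left.

v3 (this file, lead c1) — RESHAPE onto the shared research statement. Crux #3's line `Sketch` (lead c1 of
stmt-1835) has reduced `AveragedTypeIBlowup` to ONE chain-level statement, `stub_threshold` (band-kernel
Volterra chain of a Tao cascade circuit from a ray datum: Type-I functional bound + no longer chain solution),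
with all plumbing LANDED under `Theorems/PerpetualPumpAveragedTypeIBlowup*.lean` (importable, imported here).
The fibre formulation of v2 carried an a.e./pointwise wart in clause (iii) (`modeWeight ≠ 0` is only a.e.
equivalent to membership in the frequency region) and duplicated that plumbing; v3 drops it and states the
core in the chain vocabulary, DECOMPOSED AT THE END-GAME (the part crux #3's registered stubs do not cover):

* `stub_staircase` (RESEARCH CORE, lead; = the content of stmt-1835's `stub_thresholdCore` up to its last two
  steps): a chain solution in crux #3's class carrying a STAIRCASE CERTIFICATE — critical envelope on every mode,
  geometric tail above the front, Type-I clock `S − T_k ≤ c₂ (1+ε₀)^{-2k}`, charged front carrier at each `T_k`;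
* `stub_majorantOfEnvelope` (riskless): the certificate on `Y` gives the same certificate on Tao's band
  majorants `b_{i,n}(t) = e^{-4π²(1+ε₀)^{2n}t}|A|1 + ∫₀ᵗ |quadTerm(Y)_{i,n}(s)| e^{-4π²(1+ε₀)^{2n}(t-s)} ds`;
* `stub_summation` (riskless, Mathlib-only): a certified majorant family has the TYPE-I FUNCTIONAL BOUND
  `Σ_{i,n} (1+ε₀)^{3n/2} b_{i,n}(t) ≤ M (S−t)^{-1/2}`;
* `stub_noLonger` (riskless): weighted unboundedness + uniqueness (`chain_unique`, landed) ⇒ no chain solution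
  on a longer interval.
Composition (sorry-free modulo the four stubs): `coreThreshold_of_parts` = stmt-1835's `stub_threshold`
statement VERBATIM (so a proof of either seat's core closes both cruxes), then crux #3's glue copied verbatim
(`chain_of_parts`, `cascadeTypeI_of_parts`, `averagedTypeIBlowup_of_parts`; credit: Cruxes/AveragedTypeIBlowup/
Lines/Sketch.lean) and `PumpTransfer_of` BY NAME. Independently, `PumpTransfer` follows from the crux decl
`AveragedTypeIBlowup` by `pumpTransfer_of_averagedTypeIBlowup` below (by-name closure route the moment
stmt-1835 closes).
-/

set_option linter.dupNamespace false
set_option linter.unusedVariables false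

noncomputable section

open MeasureTheory Set Filter Topology
open scoped ENNReal
open Literature.Analysis.FluidPDE Literature.Analysis.FluidPDE.Tao2016
open Literature.Analysis.FluidPDE.TaoCascade (quadTerm IsSymmetricCoeff IsCancellingCoeff)
open Summit.NavierStokesRegularity.NavierStokesRegularity.Theorems.PerpetualPumpAveragedTypeIBlowup

namespace Summit.NavierStokesRegularity.NavierStokesRegularity.Cruxes.PumpTransfer.SketchLine

/-- Local notation for `ℝ³`. -/
local notation "ℝ³" => EuclideanSpace ℝ (Fin 3)

/-! ## The registered stubs (v3) -/

/-- **Stub `staircase` (RESEARCH CORE, lead).** For every `0 < ε₀ ≤ 1/2` there are Tao wavelet data, a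
symmetric cancelling circuit, a ray datum `A ψ_{i₀,n₀}`, a time `S > 0` and a chain solution `Y` on `[0,S)`
in the class of stmt-1835 (continuous on `[0,S)`, no modes below `n₀`, `(1+ε₀)^{20n}`-weighted bounds on
compact sub-intervals, the band-kernel Volterra identity) carrying a STAIRCASE CERTIFICATE: (Y1) the critical
envelope `|Y_{i,n}(s)| ≤ K (1+ε₀)^{-n/2}` for all modes and times; (Y3) checkpoint times `T_k ∈ [0,S)`,
`T_0 = 0`, with the Type-I clock `S − T_k ≤ c₂ (1+ε₀)^{-2k}`; (Y2) before `T_{k+1}` every mode at scale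
`n ≥ n₀+k+2` is geometrically small, `|Y_{i,n}(s)| ≤ K (1+ε₀)^{-n/2} (2(1+ε₀))^{n₀+k+1-n}`; (Y4) at `T_k` the
front carrier is charged, `|Y_{i₀,n₀+k}(T_k)| ≥ b₀ (1+ε₀)^{-(n₀+k)/2}`, `b₀ > 0`. Intended proof (shared with
stmt-1835 `stub_thresholdCore`, architecture v2): m = 2 seeded graded Toda circuit, window one-step theorem
(incubation from the ε-seed, integrable transfer gate, quiet trail, slaved modes above) + intermediate-value
nesting on the datum amplitude; `T_{k+1}` = completion of the `k`-th transfer. [cite: Tao2016AveragedNS, §5.2 Prop. 5.1, §6 and §1.1 p. 8 footnote] -/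
theorem stub_staircase :
    ∀ ε₀ : ℝ, 0 < ε₀ → ε₀ ≤ 1 / 2 →
      ∃ (m : ℕ) (𝒟 : CascadeWaveletData ε₀ m) (α : Fin m → Fin m → Fin m → ℤ × ℤ × ℤ → ℝ),
        IsSymmetricCoeff α ∧ IsCancellingCoeff α ∧
        ∃ (i₀ : Fin m) (n₀ : ℤ) (A S K c₂ b₀ : ℝ) (T : ℕ → ℝ) (Y : Fin m → ℤ → ℝ → ℝ),
          0 < S ∧ 0 ≤ K ∧ 0 < c₂ ∧ 0 < b₀ ∧
          (∀ i n, ContinuousOn (Y i n) (Ico 0 S)) ∧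
          (∀ i n t, n < n₀ → Y i n t = 0) ∧
          (∀ S' : ℝ, S' < S → ∃ C : ℝ, ∀ (i : Fin m) (n : ℤ), ∀ t ∈ Icc 0 S',
            (1 + ε₀) ^ ((20 : ℝ) * n) * |Y i n t| ≤ C) ∧
          (∀ (i : Fin m) (n : ℤ), ∀ t ∈ Ico 0 S,
            Y i n t = (if i = i₀ ∧ n = n₀ then A else 0) *
                (pairing (heat t (cascadeWavelet ε₀ (𝒟.ψ i) n)) (cascadeWavelet ε₀ (𝒟.ψ i) n)).re +
              ∫ s in (0 : ℝ)..t,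
                (pairing (heat (t - s) (cascadeWavelet ε₀ (𝒟.ψ i) n)) (cascadeWavelet ε₀ (𝒟.ψ i) n)).re *
                  quadTerm ε₀ α Y i n s) ∧
          (∀ (i : Fin m) (n : ℤ), ∀ s ∈ Ico 0 S, |Y i n s| ≤ K * (1 + ε₀) ^ (-(n : ℝ) / 2)) ∧
          T 0 = 0 ∧ (∀ k : ℕ, 0 ≤ T k ∧ T k < S) ∧
          (∀ k : ℕ, S - T k ≤ c₂ / (1 + ε₀) ^ (2 * k)) ∧
          (∀ k : ℕ, ∀ s ∈ Ico 0 (T (k + 1)), s < S → ∀ (i : Fin m) (n : ℤ), n₀ + k + 2 ≤ n →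
            |Y i n s| ≤ K * (1 + ε₀) ^ (-(n : ℝ) / 2) * (2 * (1 + ε₀)) ^ (n₀ + k + 1 - n)) ∧
          (∀ k : ℕ, b₀ * (1 + ε₀) ^ (-((n₀ + k : ℤ) : ℝ) / 2) ≤ |Y i₀ (n₀ + k) (T k)|) := by
  sorry

/-- **Stub `majorantOfEnvelope` (riskless; LANDED p109860, `Theorems/PerpetualPumpPumpTransferMajorantOfEnvelope.lean`).** The staircase certificate on the coefficients `Y` passes to
Tao's band majorants `b_{i,n}(t) = e^{-4π²(1+ε₀)^{2n}t}|A|1_{(i,n)=(i₀,n₀)} + ∫₀ᵗ |quadTerm(Y)_{i,n}(s)|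
e^{-4π²(1+ε₀)^{2n}(t-s)} ds`: (B0) `b_{i,n} = 0` below `n₀` (every monomial of `quadTerm_{i,n}` has a factor at
scale `≤ n`); (B1) `b_{i,n}(t) ≤ K' (1+ε₀)^{-n/2}` (`|quadTerm_{i,n}| ≤ C_α K² (1+ε₀)^{3n/2}` under the critical
envelope, against the damping `4π²(1+ε₀)^{2n}`: `∫₀ᵗ e^{-D(t-s)} ds ≤ 1/D`); (B2) before `T_{k+1}` and for
`n ≥ n₀+k+3`, `b_{i,n}(t) ≤ K' (1+ε₀)^{-n/2} (2(1+ε₀))^{n₀+k+2-n}` (both factors of every monomial lie at scales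
`≥ n-1 ≥ n₀+k+2`). [cite: Tao2016AveragedNS, §4 (4.8) and p. 22 (4.14)] -/
theorem stub_majorantOfEnvelope :
    ∀ {ε₀ : ℝ}, 0 < ε₀ → ε₀ ≤ 1 → ∀ {m : ℕ} (α : Fin m → Fin m → Fin m → ℤ × ℤ × ℤ → ℝ)
      (i₀ : Fin m) (n₀ : ℤ) (A S K : ℝ) (T : ℕ → ℝ) (Y : Fin m → ℤ → ℝ → ℝ), 0 ≤ K →
      (∀ i n, ContinuousOn (Y i n) (Ico 0 S)) →
      (∀ i n t, n < n₀ → Y i n t = 0) →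
      |A| ≤ K * (1 + ε₀) ^ (-(n₀ : ℝ) / 2) →
      (∀ (i : Fin m) (n : ℤ), ∀ s ∈ Ico 0 S, |Y i n s| ≤ K * (1 + ε₀) ^ (-(n : ℝ) / 2)) →
      (∀ k : ℕ, ∀ s ∈ Ico 0 (T (k + 1)), s < S → ∀ (i : Fin m) (n : ℤ), n₀ + k + 2 ≤ n →
        |Y i n s| ≤ K * (1 + ε₀) ^ (-(n : ℝ) / 2) * (2 * (1 + ε₀)) ^ (n₀ + k + 1 - n)) →
      ∃ K' : ℝ, 0 ≤ K' ∧
        (∀ (i : Fin m) (n : ℤ) (t : ℝ), n < n₀ →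
          Real.exp (-(4 * Real.pi ^ 2 * (1 + ε₀) ^ (2 * n) * t)) * (if i = i₀ ∧ n = n₀ then |A| else 0) +
            ∫ s in (0 : ℝ)..t, |quadTerm ε₀ α Y i n s| *
              Real.exp (-(4 * Real.pi ^ 2 * (1 + ε₀) ^ (2 * n) * (t - s))) = 0) ∧
        (∀ (i : Fin m) (n : ℤ), ∀ t ∈ Ico 0 S,
          Real.exp (-(4 * Real.pi ^ 2 * (1 + ε₀) ^ (2 * n) * t)) * (if i = i₀ ∧ n = n₀ then |A| else 0) +
            ∫ s in (0 : ℝ)..t, |quadTerm ε₀ α Y i n s| *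
              Real.exp (-(4 * Real.pi ^ 2 * (1 + ε₀) ^ (2 * n) * (t - s))) ≤
            K' * (1 + ε₀) ^ (-(n : ℝ) / 2)) ∧
        (∀ k : ℕ, ∀ t ∈ Ico 0 (T (k + 1)), t < S → ∀ (i : Fin m) (n : ℤ), n₀ + k + 3 ≤ n →
          Real.exp (-(4 * Real.pi ^ 2 * (1 + ε₀) ^ (2 * n) * t)) * (if i = i₀ ∧ n = n₀ then |A| else 0) +
            ∫ s in (0 : ℝ)..t, |quadTerm ε₀ α Y i n s| *
              Real.exp (-(4 * Real.pi ^ 2 * (1 + ε₀) ^ (2 * n) * (t - s))) ≤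
            K' * (1 + ε₀) ^ (-(n : ℝ) / 2) * (2 * (1 + ε₀)) ^ (n₀ + k + 2 - n)) :=
  Summit.NavierStokesRegularity.NavierStokesRegularity.Theorems.PerpetualPumpPumpTransfer.stub_majorantOfEnvelope

/-- **Stub `summation` (riskless, Mathlib-only; LANDED p108846, `Theorems/PerpetualPumpPumpTransferSummation.lean`): the Type-I functional bound of a certified majorant family.**
If nonnegative-or-not quantities `b_{i,n}(t)` vanish (are `≤ 0`) below `n₀`, obey the critical envelope
`b_{i,n}(t) ≤ K (1+ε₀)^{-n/2}` on `[0,S)`, are geometrically small above the front (`b_{i,n}(t) ≤ K (1+ε₀)^{-n/2}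
(2(1+ε₀))^{n₀+k+2-n}` for `t < T_{k+1}`, `n ≥ n₀+k+3`) and the checkpoints obey the Type-I clock `T_0 = 0`,
`S − T_k ≤ c₂ (1+ε₀)^{-2k}`, then `Σ_{i,n} (1+ε₀)^{3n/2} b_{i,n}(t) ≤ M (S−t)^{-1/2}` on `[0,S)` (in `ℝ≥0∞`): at time
`t` pick the least `k` with `t < T_{k+1}` (it exists because `T_k → S`, and then `T_k ≤ t`); the weighted family is
dominated by `K (1+ε₀)^{n₀+k+2} ρ^{|n-(n₀+k+2)|}`, `ρ = max((1+ε₀)^{-1}, ½)`, whose sum is `≲ (1+ε₀)^{k}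
≤ (c₂/(S−t))^{1/2}`. [folklore] -/
theorem stub_summation :
    ∀ {ε₀ : ℝ}, 0 < ε₀ → ε₀ ≤ 1 → ∀ {m : ℕ} (n₀ : ℤ) (S K c₂ : ℝ) (T : ℕ → ℝ)
      (b : Fin m → ℤ → ℝ → ℝ), 0 < S → 0 ≤ K → 0 < c₂ →
      T 0 = 0 → (∀ k : ℕ, S - T k ≤ c₂ / (1 + ε₀) ^ (2 * k)) →
      (∀ (i : Fin m) (n : ℤ) (t : ℝ), n < n₀ → b i n t ≤ 0) →
      (∀ (i : Fin m) (n : ℤ), ∀ t ∈ Ico 0 S, b i n t ≤ K * (1 + ε₀) ^ (-(n : ℝ) / 2)) →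
      (∀ k : ℕ, ∀ t ∈ Ico 0 (T (k + 1)), t < S → ∀ (i : Fin m) (n : ℤ), n₀ + k + 3 ≤ n →
        b i n t ≤ K * (1 + ε₀) ^ (-(n : ℝ) / 2) * (2 * (1 + ε₀)) ^ (n₀ + k + 2 - n)) →
      ∃ M : ℝ, ∀ t ∈ Ico 0 S,
        (∑' p : Fin m × ℤ, ENNReal.ofReal ((1 + ε₀) ^ ((3 : ℝ) * p.2 / 2) * b p.1 p.2 t)) ≤
          ENNReal.ofReal (M / Real.sqrt (S - t)) :=
  Summit.NavierStokesRegularity.NavierStokesRegularity.Theorems.PerpetualPumpPumpTransfer.stub_summation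

/-- **Stub `noLonger` (riskless; LANDED p109988, `Theorems/PerpetualPumpPumpTransferNoLonger.lean`): weighted blow-up forbids a longer chain solution.** If a chain solution `Y`
on `[0,S)` in the class of stmt-1835 is unbounded in the weight `(1+ε₀)^{10n}`, no chain solution from the same
datum exists on any `[0,S')`, `S' > S`: by uniqueness in the class (`chain_unique`, landed in
`Theorems/PerpetualPumpAveragedTypeIBlowupDieGlobalUnique.lean`, with `|k| ≤ 1` and continuity of the band
kernel from `Theorems/PerpetualPumpAveragedTypeIBlowupChainContinuation.lean`) the longer solution agrees with
`Y` on `[0,S)`, and it is `(1+ε₀)^{20n}`-bounded on the compact `[0,S]` while vanishing below `n₀` — so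
`(1+ε₀)^{10n}|Y| ≤ C (1+ε₀)^{-10 n₀}` on `[0,S)`, a contradiction. [folklore] -/
theorem stub_noLonger :
    ∀ {ε₀ : ℝ}, 0 < ε₀ → ε₀ ≤ 1 → ∀ {m : ℕ} (𝒟 : CascadeWaveletData ε₀ m)
      (α : Fin m → Fin m → Fin m → ℤ × ℤ × ℤ → ℝ) (i₀ : Fin m) (n₀ : ℤ) (A S : ℝ)
      (Y : Fin m → ℤ → ℝ → ℝ), 0 < S →
      (∀ i n, ContinuousOn (Y i n) (Ico 0 S)) →
      (∀ i n t, n < n₀ → Y i n t = 0) →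
      (∀ S' : ℝ, S' < S → ∃ C : ℝ, ∀ (i : Fin m) (n : ℤ), ∀ t ∈ Icc 0 S',
        (1 + ε₀) ^ ((20 : ℝ) * n) * |Y i n t| ≤ C) →
      (∀ (i : Fin m) (n : ℤ), ∀ t ∈ Ico 0 S,
        Y i n t = (if i = i₀ ∧ n = n₀ then A else 0) *
            (pairing (heat t (cascadeWavelet ε₀ (𝒟.ψ i) n)) (cascadeWavelet ε₀ (𝒟.ψ i) n)).re +
          ∫ s in (0 : ℝ)..t,
            (pairing (heat (t - s) (cascadeWavelet ε₀ (𝒟.ψ i) n)) (cascadeWavelet ε₀ (𝒟.ψ i) n)).re *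
              quadTerm ε₀ α Y i n s) →
      (∀ C : ℝ, ∃ t ∈ Ico 0 S, ∃ (i : Fin m) (n : ℤ), C < (1 + ε₀) ^ ((10 : ℝ) * n) * |Y i n t|) →
      ¬ ∃ (S' : ℝ) (Y' : Fin m → ℤ → ℝ → ℝ), S < S' ∧
        (∀ i n, ContinuousOn (Y' i n) (Ico 0 S')) ∧
        (∀ i n t, n < n₀ → Y' i n t = 0) ∧
        (∀ S'' : ℝ, S'' < S' → ∃ C : ℝ, ∀ (i : Fin m) (n : ℤ), ∀ t ∈ Icc 0 S'',
          (1 + ε₀) ^ ((20 : ℝ) * n) * |Y' i n t| ≤ C) ∧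
        (∀ (i : Fin m) (n : ℤ), ∀ t ∈ Ico 0 S',
          Y' i n t = (if i = i₀ ∧ n = n₀ then A else 0) *
              (pairing (heat t (cascadeWavelet ε₀ (𝒟.ψ i) n)) (cascadeWavelet ε₀ (𝒟.ψ i) n)).re +
            ∫ s in (0 : ℝ)..t,
              (pairing (heat (t - s) (cascadeWavelet ε₀ (𝒟.ψ i) n)) (cascadeWavelet ε₀ (𝒟.ψ i) n)).re *
                quadTerm ε₀ α Y' i n s) :=
  Summit.NavierStokesRegularity.NavierStokesRegularity.Theorems.PerpetualPumpPumpTransfer.stub_noLonger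

/-! ## Sorry-free glue -/

/-- **Weighted unboundedness from the charged front (Y4) and the clock.** If at checkpoint times
`T_k ∈ [0,S)` the front carrier obeys `|Y_{i₀,n₀+k}(T_k)| ≥ b₀ (1+ε₀)^{-(n₀+k)/2}` with `b₀ > 0`, then
`(1+ε₀)^{10n}|Y_{i,n}(t)|` is unbounded on `[0,S)` (it is `≥ b₀ (1+ε₀)^{19(n₀+k)/2} → ∞`). [folklore] -/
theorem unbounded_of_chargedFront {ε₀ : ℝ} (hε₀ : 0 < ε₀) {m : ℕ} (i₀ : Fin m) (n₀ : ℤ) (S b₀ : ℝ)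
    (T : ℕ → ℝ) (Y : Fin m → ℤ → ℝ → ℝ) (hb₀ : 0 < b₀) (hT : ∀ k : ℕ, 0 ≤ T k ∧ T k < S)
    (hY : ∀ k : ℕ, b₀ * (1 + ε₀) ^ (-((n₀ + k : ℤ) : ℝ) / 2) ≤ |Y i₀ (n₀ + k) (T k)|) :
    ∀ C : ℝ, ∃ t ∈ Ico 0 S, ∃ (i : Fin m) (n : ℤ), C < (1 + ε₀) ^ ((10 : ℝ) * n) * |Y i n t| := by
  intro C
  have hl : (1 : ℝ) < 1 + ε₀ := by linarith
  have hl0 : (0 : ℝ) < 1 + ε₀ := by linarith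
  -- the lower bound `b₀ (1+ε₀)^{19 (n₀+k)/2}` tends to `+∞` with `k`
  have htend : Tendsto (fun k : ℕ => b₀ * (1 + ε₀) ^ ((19 : ℝ) * ((n₀ + k : ℤ) : ℝ) / 2)) atTop atTop := by
    refine Tendsto.const_mul_atTop hb₀ ?_
    have h1 : Tendsto (fun k : ℕ => (19 : ℝ) * ((n₀ + k : ℤ) : ℝ) / 2) atTop atTop := by
      have : Tendsto (fun k : ℕ => ((n₀ + k : ℤ) : ℝ)) atTop atTop := by
        refine tendsto_atTop_atTop.2 fun b => ⟨Nat.ceil (b - n₀), fun k hk => ?_⟩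
        have hk' : (b - n₀ : ℝ) ≤ k := (Nat.le_ceil _).trans (by exact_mod_cast hk)
        push_cast
        linarith
      refine Tendsto.atTop_div_const (by norm_num) (Tendsto.const_mul_atTop (by norm_num) this)
    exact (tendsto_rpow_atTop_of_base_gt_one _ hl).comp h1
  obtain ⟨k, hk⟩ := (htend.eventually_gt_atTop C).exists
  refine ⟨T k, ⟨(hT k).1, (hT k).2⟩, i₀, n₀ + k, lt_of_lt_of_le hk ?_⟩
  have hpow : (1 + ε₀) ^ ((19 : ℝ) * ((n₀ + k : ℤ) : ℝ) / 2) =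
      (1 + ε₀) ^ ((10 : ℝ) * ((n₀ + k : ℤ) : ℝ)) * (1 + ε₀) ^ (-((n₀ + k : ℤ) : ℝ) / 2) := by
    rw [← Real.rpow_add hl0]
    congr 1
    ring
  rw [hpow, mul_comm b₀, mul_assoc]
  refine mul_le_mul_of_nonneg_left ?_ (Real.rpow_nonneg hl0.le _)
  simpa [mul_comm] using hY k

/-- **The shared research statement: stmt-1835's `stub_threshold`, VERBATIM, from the four stubs.** For
`0 < ε₀ ≤ 1/2`: the staircase solution of `stub_staircase`; its band majorants are certified
(`stub_majorantOfEnvelope`, the datum bound coming from (Y1) at `t = 0` and `k_{i₀,n₀}(0) = 1`, `stub_kernel`);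
the functional bound by `stub_summation`; weighted unboundedness from the charged front; no longer solution by
`stub_noLonger`. [cite: Tao2016AveragedNS, §5.2 Prop. 5.1, §6 and §1.1 p. 8 footnote] -/
theorem coreThreshold_of_parts :
    ∀ ε₀ : ℝ, 0 < ε₀ → ε₀ ≤ 1 / 2 →
      ∃ (m : ℕ) (𝒟 : CascadeWaveletData ε₀ m) (α : Fin m → Fin m → Fin m → ℤ × ℤ × ℤ → ℝ),
        IsSymmetricCoeff α ∧ IsCancellingCoeff α ∧
        ∃ (i₀ : Fin m) (n₀ : ℤ) (A S : ℝ), 0 < S ∧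
          (∃ Y : Fin m → ℤ → ℝ → ℝ,
            (∀ i n, ContinuousOn (Y i n) (Ico 0 S)) ∧
            (∀ i n t, n < n₀ → Y i n t = 0) ∧
            (∀ S' : ℝ, S' < S → ∃ C : ℝ, ∀ (i : Fin m) (n : ℤ), ∀ t ∈ Icc 0 S',
              (1 + ε₀) ^ ((20 : ℝ) * n) * |Y i n t| ≤ C) ∧
            (∀ (i : Fin m) (n : ℤ), ∀ t ∈ Ico 0 S,
              Y i n t = (if i = i₀ ∧ n = n₀ then A else 0) *
                  (pairing (heat t (cascadeWavelet ε₀ (𝒟.ψ i) n)) (cascadeWavelet ε₀ (𝒟.ψ i) n)).re +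
                ∫ s in (0 : ℝ)..t,
                  (pairing (heat (t - s) (cascadeWavelet ε₀ (𝒟.ψ i) n)) (cascadeWavelet ε₀ (𝒟.ψ i) n)).re *
                    quadTerm ε₀ α Y i n s) ∧
            (∃ M : ℝ, ∀ t ∈ Ico 0 S,
              (∑' p : Fin m × ℤ, ENNReal.ofReal ((1 + ε₀) ^ ((3 : ℝ) * p.2 / 2) *
                (Real.exp (-(4 * Real.pi ^ 2 * (1 + ε₀) ^ (2 * p.2) * t)) *
                    (if p.1 = i₀ ∧ p.2 = n₀ then |A| else 0) +
                  ∫ s in (0 : ℝ)..t, |quadTerm ε₀ α Y p.1 p.2 s| *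
                    Real.exp (-(4 * Real.pi ^ 2 * (1 + ε₀) ^ (2 * p.2) * (t - s)))))) ≤
                ENNReal.ofReal (M / Real.sqrt (S - t)))) ∧
          ¬ ∃ (S' : ℝ) (Y' : Fin m → ℤ → ℝ → ℝ), S < S' ∧
            (∀ i n, ContinuousOn (Y' i n) (Ico 0 S')) ∧
            (∀ i n t, n < n₀ → Y' i n t = 0) ∧
            (∀ S'' : ℝ, S'' < S' → ∃ C : ℝ, ∀ (i : Fin m) (n : ℤ), ∀ t ∈ Icc 0 S'',
              (1 + ε₀) ^ ((20 : ℝ) * n) * |Y' i n t| ≤ C) ∧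
            (∀ (i : Fin m) (n : ℤ), ∀ t ∈ Ico 0 S',
              Y' i n t = (if i = i₀ ∧ n = n₀ then A else 0) *
                  (pairing (heat t (cascadeWavelet ε₀ (𝒟.ψ i) n)) (cascadeWavelet ε₀ (𝒟.ψ i) n)).re +
                ∫ s in (0 : ℝ)..t,
                  (pairing (heat (t - s) (cascadeWavelet ε₀ (𝒟.ψ i) n)) (cascadeWavelet ε₀ (𝒟.ψ i) n)).re *
                    quadTerm ε₀ α Y' i n s) := by
  intro ε₀ hε₀ hε₀half
  have hε₀1 : ε₀ ≤ 1 := hε₀half.trans (by norm_num)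
  have hl0 : (0 : ℝ) < 1 + ε₀ := by linarith
  obtain ⟨m, 𝒟, α, hsymm, hcanc, i₀, n₀, A, S, K, c₂, b₀, T, Y, hS, hK, hc₂, hb₀, hcont, hlow, hdec, hchain,
    hY1, hT0, hT, hclock, hY2, hY4⟩ := stub_staircase ε₀ hε₀ hε₀half
  -- the datum bound `|A| ≤ K (1+ε₀)^{-n₀/2}` from (Y1) at `t = 0` and `k(0) = 1`
  have hA : |A| ≤ K * (1 + ε₀) ^ (-(n₀ : ℝ) / 2) := by
    have h0 : (0 : ℝ) ∈ Ico 0 S := ⟨le_rfl, hS⟩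
    have hk0 := (stub_kernel hε₀ hε₀1 𝒟 i₀ n₀).1
    have hY0 : Y i₀ n₀ 0 = A := by
      rw [hchain i₀ n₀ 0 h0, hk0]
      simp
    have := hY1 i₀ n₀ 0 h0
    rwa [hY0] at this
  obtain ⟨K', hK', hB0, hB1, hB2⟩ :=
    stub_majorantOfEnvelope hε₀ hε₀1 α i₀ n₀ A S K T Y hK hcont hlow hA hY1 hY2
  obtain ⟨M, hM⟩ := stub_summation hε₀ hε₀1 n₀ S K' c₂ T
    (fun i n t => Real.exp (-(4 * Real.pi ^ 2 * (1 + ε₀) ^ (2 * n) * t)) *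
        (if i = i₀ ∧ n = n₀ then |A| else 0) +
      ∫ s in (0 : ℝ)..t, |quadTerm ε₀ α Y i n s| * Real.exp (-(4 * Real.pi ^ 2 * (1 + ε₀) ^ (2 * n) * (t - s))))
    hS hK' hc₂ hT0 hclock (fun i n t hn => (hB0 i n t hn).le) hB1 hB2
  have hunb := unbounded_of_chargedFront hε₀ i₀ n₀ S b₀ T Y hb₀ hT hY4
  exact ⟨m, 𝒟, α, hsymm, hcanc, i₀, n₀, A, S, hS, ⟨Y, hcont, hlow, hdec, hchain, M, hM⟩,
    stub_noLonger hε₀ hε₀1 𝒟 α i₀ n₀ A S Y hS hcont hlow hdec hchain hunb⟩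

/-! ## Crux #3's glue, copied verbatim (credit: Cruxes/AveragedTypeIBlowup/Lines/Sketch.lean, leads -0/c1 of
stmt-1835), with `coreThreshold_of_parts` in place of `stub_threshold`. -/

/-- **The chain-level Type-I blow-up**: the maximal chain solution of `coreThreshold_of_parts` cannot stay
bounded in the `H¹⁰` weight, by `stub_chainContinuation` (landed). [cite: Tao2016AveragedNS, §4] -/
theorem chain_of_parts :
    ∀ ε₀ : ℝ, 0 < ε₀ → ε₀ ≤ 1 / 2 →
      ∃ (m : ℕ) (𝒟 : CascadeWaveletData ε₀ m) (α : Fin m → Fin m → Fin m → ℤ × ℤ × ℤ → ℝ),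
        IsSymmetricCoeff α ∧ IsCancellingCoeff α ∧
        ∃ (i₀ : Fin m) (n₀ : ℤ) (A S : ℝ) (Y : Fin m → ℤ → ℝ → ℝ), 0 < S ∧
          (∀ i n, ContinuousOn (Y i n) (Ico 0 S)) ∧
          (∀ i n t, n < n₀ → Y i n t = 0) ∧
          (∀ S' : ℝ, S' < S → ∃ C : ℝ, ∀ (i : Fin m) (n : ℤ), ∀ t ∈ Icc 0 S',
            (1 + ε₀) ^ ((20 : ℝ) * n) * |Y i n t| ≤ C) ∧
          (∀ (i : Fin m) (n : ℤ), ∀ t ∈ Ico 0 S,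
            Y i n t = (if i = i₀ ∧ n = n₀ then A else 0) *
                (pairing (heat t (cascadeWavelet ε₀ (𝒟.ψ i) n)) (cascadeWavelet ε₀ (𝒟.ψ i) n)).re +
              ∫ s in (0 : ℝ)..t,
                (pairing (heat (t - s) (cascadeWavelet ε₀ (𝒟.ψ i) n)) (cascadeWavelet ε₀ (𝒟.ψ i) n)).re *
                  quadTerm ε₀ α Y i n s) ∧
          (∃ M : ℝ, ∀ t ∈ Ico 0 S,
            (∑' p : Fin m × ℤ, ENNReal.ofReal ((1 + ε₀) ^ ((3 : ℝ) * p.2 / 2) *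
              (Real.exp (-(4 * Real.pi ^ 2 * (1 + ε₀) ^ (2 * p.2) * t)) *
                  (if p.1 = i₀ ∧ p.2 = n₀ then |A| else 0) +
                ∫ s in (0 : ℝ)..t, |quadTerm ε₀ α Y p.1 p.2 s| *
                  Real.exp (-(4 * Real.pi ^ 2 * (1 + ε₀) ^ (2 * p.2) * (t - s)))))) ≤
              ENNReal.ofReal (M / Real.sqrt (S - t))) ∧
          (∀ C : ℝ, ∃ t ∈ Ico 0 S, ∃ (i : Fin m) (n : ℤ), C < (1 + ε₀) ^ ((10 : ℝ) * n) * |Y i n t|) := by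
  intro ε₀ hε₀ hε₀half
  have hε₀1 : ε₀ ≤ 1 := hε₀half.trans (by norm_num)
  obtain ⟨m, 𝒟, α, hsymm, hcanc, i₀, n₀, A, S, hS, ⟨Y, hcont, hlow, hdec, hchain, hM⟩, hmax⟩ :=
    coreThreshold_of_parts ε₀ hε₀ hε₀half
  refine ⟨m, 𝒟, α, hsymm, hcanc, i₀, n₀, A, S, Y, hS, hcont, hlow, hdec, hchain, hM, ?_⟩
  by_contra hbd
  push Not at hbd
  obtain ⟨C, hC⟩ := hbd
  obtain ⟨S', Y', hSS', hcont', hlow', hdec', hchain', -⟩ :=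
    stub_chainContinuation hε₀ hε₀1 𝒟 α i₀ n₀ A S Y hS hcont hlow hdec hchain
      ⟨C, fun i n t ht => hC t ht i n⟩
  exact hmax ⟨S', Y', hSS', hcont', hlow', hdec', hchain'⟩

/-- Scalar multiples of divergence-free Schwartz fields are divergence free. [folklore] -/
theorem isDivFree_smul (A : ℝ) {ψ : SchwartzMap ℝ³ ℝ³} (hψ : VectorCalculus.IsDivFree ⇑ψ) :
    VectorCalculus.IsDivFree ⇑(A • ψ) := by
  intro x
  have hd : DifferentiableAt ℝ (⇑ψ) x := (ψ.differentiable).differentiableAt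
  have hcoe : (⇑(A • ψ) : ℝ³ → ℝ³) = A • (⇑ψ) := rfl
  unfold VectorCalculus.divergence
  rw [hcoe, fderiv_const_smul hd A, ContinuousLinearMap.toLinearMap_smul, map_smul]
  have h0 := hψ x
  unfold VectorCalculus.divergence at h0
  rw [h0, smul_zero]

/-- `quadTerm` only reads the coefficient family at the evaluation time. [folklore] -/
theorem quadTerm_congr_at {ε₀ : ℝ} {m : ℕ} (α : Fin m → Fin m → Fin m → ℤ × ℤ × ℤ → ℝ)
    {X X' : Fin m → ℤ → ℝ → ℝ} {s : ℝ} (h : ∀ (j : Fin m) (k : ℤ), X j k s = X' j k s) (i : Fin m) (n : ℤ) :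
    quadTerm ε₀ α X i n s = quadTerm ε₀ α X' i n s := by
  unfold quadTerm
  simp only [h]

/-- **The cascade-level Type-I blow-up at arbitrarily fine dyadic parameter** (the hypothesis of
`stub_transfer`), from `chain_of_parts` and the landed synthesis/rate/non-extension plumbing of stmt-1835.
[cite: Tao2016AveragedNS, §4] -/
theorem cascadeTypeI_of_parts :
    ∀ ε₁ : ℝ, 0 < ε₁ → ∃ ε₀ : ℝ, 0 < ε₀ ∧ ε₀ ≤ ε₁ ∧
      ∃ C : L2C → L2C → L2C → ℂ, IsLocalCascadeForm ε₀ C ∧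
        (∀ u v w, MemH10df u → MemH10df v → MemH10df w → C u v w = C v u w) ∧
        (∀ u, MemH10df u → C u u u = 0) ∧
        ∃ u₀ : SchwartzMap ℝ³ ℝ³, VectorCalculus.IsDivFree ⇑u₀ ∧ ∃ S : ℝ, 0 < S ∧ ∃ u : ℝ → L2C,
          IsMildSolutionFor C (schwartzL2 u₀) (Ico 0 S) u ∧
          (∃ M : ℝ, ∀ t ∈ Ico 0 S, eLpNorm (u t) ⊤ volume ≤ ENNReal.ofReal (M / Real.sqrt (S - t))) ∧
          ¬ ∃ S' : ℝ, S < S' ∧ ∃ v : ℝ → L2C,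
            IsMildSolutionFor C (schwartzL2 u₀) (Ico 0 S') v ∧ ∀ t ∈ Ico 0 S, v t = u t := by
  intro ε₁ hε₁
  set ε₀ : ℝ := min ε₁ (1 / 2) with hε₀def
  have hε₀ : 0 < ε₀ := lt_min hε₁ (by norm_num)
  have hε₀half : ε₀ ≤ 1 / 2 := min_le_right _ _
  have hε₀1 : ε₀ ≤ 1 := hε₀half.trans (by norm_num)
  have hl : (0 : ℝ) < 1 + ε₀ := by positivity
  obtain ⟨m, 𝒟, α, hsymm, hcanc, i₀, n₀, A, S, Y, hS, hcont, hlow, hdec, hchain, ⟨M, hM⟩, hblow⟩ :=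
    chain_of_parts ε₀ hε₀ hε₀half
  obtain ⟨u, hmem, hcts, hsum⟩ := stub_synthField hε₀ hε₀1 𝒟 α i₀ n₀ A S Y hS hcont hlow hdec hchain
  obtain ⟨hmild, hcoeff⟩ :=
    stub_synthMild hε₀ hε₀1 𝒟 α i₀ n₀ A S Y hS hcont hlow hdec hchain u hmem hcts hsum
  obtain ⟨c, hc0, hc⟩ := stub_supBound hε₀ hε₀1 𝒟 α
  -- the datum as a Schwartz field
  set u₀ : SchwartzMap ℝ³ ℝ³ := A • schwartzWavelet hl (𝒟.ψ i₀) n₀ with hu₀def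
  have hdat : schwartzL2 u₀ = (A : ℂ) • cascadeWavelet ε₀ (𝒟.ψ i₀) n₀ := by
    rw [hu₀def, schwartzL2_smul, schwartzL2_schwartzWavelet]
  refine ⟨ε₀, hε₀, min_le_left _ _, cascadeOperatorForm ε₀ 𝒟.ψ α,
    isLocalCascadeForm_cascadeOperatorForm hε₀ hε₀1 𝒟 α,
    fun a b w _ _ _ => cascadeOperatorForm_symm ε₀ 𝒟.ψ hsymm a b w,
    fun a _ => cascadeOperatorForm_cancel ε₀ 𝒟.ψ hcanc a,
    u₀, isDivFree_smul A (isDivFree_schwartzWavelet hl (𝒟.isDivFree i₀) n₀), S, hS, u, ?_, ?_, ?_⟩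
  · rw [hdat]
    exact hmild
  · -- the Type-I rate
    refine ⟨c * M, fun t ht => ?_⟩
    have h1 := hc i₀ n₀ A S u hmild t ht
    have h2 : ∀ p : Fin m × ℤ,
        ENNReal.ofReal ((1 + ε₀) ^ ((3 : ℝ) * p.2 / 2) * ‖modeProjection 𝒟 p.1 p.2 (u t)‖) ≤
          ENNReal.ofReal ((1 + ε₀) ^ ((3 : ℝ) * p.2 / 2) *
            (Real.exp (-(4 * Real.pi ^ 2 * (1 + ε₀) ^ (2 * p.2) * t)) *
                (if p.1 = i₀ ∧ p.2 = n₀ then |A| else 0) +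
              ∫ s in (0 : ℝ)..t, |quadTerm ε₀ α Y p.1 p.2 s| *
                Real.exp (-(4 * Real.pi ^ 2 * (1 + ε₀) ^ (2 * p.2) * (t - s))))) := by
      intro p
      refine ENNReal.ofReal_le_ofReal (mul_le_mul_of_nonneg_left ?_ ?_)
      · have hb := stub_modeNormBound hε₀ hε₀1 𝒟 α i₀ n₀ A S u hmild p.1 p.2 t ht
        have hint : ∫ s in (0 : ℝ)..t, |quadTerm ε₀ α (modeCoeff 𝒟 u) p.1 p.2 s| *
              Real.exp (-(4 * Real.pi ^ 2 * (1 + ε₀) ^ (2 * p.2) * (t - s))) =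
            ∫ s in (0 : ℝ)..t, |quadTerm ε₀ α Y p.1 p.2 s| *
              Real.exp (-(4 * Real.pi ^ 2 * (1 + ε₀) ^ (2 * p.2) * (t - s))) := by
          refine intervalIntegral.integral_congr fun s hs => ?_
          rw [uIcc_of_le ht.1] at hs
          have hsI : s ∈ Ico 0 S := ⟨hs.1, hs.2.trans_lt ht.2⟩
          simp only [quadTerm_congr_at α (fun j k => hcoeff j k s hsI) p.1 p.2]
        rw [hint] at hb
        exact hb
      · exact Real.rpow_nonneg hl.le _
    calc eLpNorm (u t) ⊤ volume
        ≤ ENNReal.ofReal c * ∑' p : Fin m × ℤ,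
            ENNReal.ofReal ((1 + ε₀) ^ ((3 : ℝ) * p.2 / 2) * ‖modeProjection 𝒟 p.1 p.2 (u t)‖) := h1
      _ ≤ ENNReal.ofReal c * ENNReal.ofReal (M / Real.sqrt (S - t)) := by
          gcongr
          exact (ENNReal.tsum_le_tsum h2).trans (hM t ht)
      _ = ENNReal.ofReal (c * M / Real.sqrt (S - t)) := by
          rw [← ENNReal.ofReal_mul hc0, mul_div_assoc]
  · -- non-extension
    rw [hdat]
    refine stub_noext hε₀ 𝒟 (cascadeOperatorForm ε₀ 𝒟.ψ α) _ S u hmild fun K => ?_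
    obtain ⟨t, ht, i, n, hlt⟩ := hblow K
    exact ⟨t, ht, i, n, by rwa [hcoeff i n t ht]⟩

/-- **The consequent of the crux**, `AveragedTypeIBlowup` (= `¬ Thesis`, crux #3), from the four stubs via
Theorem 3.2 (`stub_transfer`, landed). [cite: Tao2016AveragedNS, Thm. 3.2] -/
theorem averagedTypeIBlowup_of_parts : Theses.PerpetualPump.AveragedTypeIBlowup := by
  unfold Theses.PerpetualPump.AveragedTypeIBlowup
  exact stub_transfer cascadeTypeI_of_parts

/-- **Composition: the crux BY NAME.** `PumpTransfer := CircuitPump → AveragedTypeIBlowup`; the antecedent is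
not used (forced by the crux's shape, Disproof `pumpTransfer_of_averagedTypeIBlowup`). The same one-liner
`fun _ => h` closes the crux from ANY proof `h` of the crux decl `AveragedTypeIBlowup` (by-name closure route
the moment stmt-1835 closes). -/
theorem PumpTransfer_of :
    Summit.NavierStokesRegularity.NavierStokesRegularity.Theses.PerpetualPump.PumpTransfer :=
  fun _ => averagedTypeIBlowup_of_parts

end Summit.NavierStokesRegularity.NavierStokesRegularity.Cruxes.PumpTransfer.SketchLine

end
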